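import Summits.CriticalPhenomena.PercolationContinuityZ3.Theorems.PercNearOneGluingNoHeavyLowerTailSahiSlotTensorConeTwoThree

/-!
# Literal-product certificates are ANTITONE IN THE DIMENSION; hence NO Sherali–Adams level-1 certificate exists for the
# order-3 slot cell `(d,3)` in ANY dimension `d ≥ 3`

Support file of the one-cut programme (crux `NoHeavyLowerTail`, stmt-CriticalPhenomena-4575; cell `prim-masterthm`, seat P3, gen 21;
`run/shared/lean/prim/prim-masterthm/prim-masterthm-p3/HIERARCHY.md` §28–§29).

`SahiSlot.LitProdCert d n` (…SahiSlotTensorCone, gen 20) says that the slot functional `patternForm d n` is, on families of up-sets of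
`[n]^d`, a NONNEGATIVE combination of products of one monotonicity literal (`x_⊥`, `1 − x_⊤`, `x_{p+e_a} − x_p`) per member — the
Sherali–Adams level-(1,…,1) / "one cut edge per member" / monotone-coupling proof format.  Gen 20 proved `¬ LitProdCert 3 3`
(an exact Farkas witness) and `LitProdCert 2 3`.

THIS FILE (pure, standard axioms on top of the gen-20 file):
* `Lit.eval_comp_tail` — on a CYLINDER family `x ∘ Fin.tail` (ignore axis `0`) every literal of `[n]^{d+1}` evaluates to a literal of
  `[n]^d` (`Lit.tailLit`), except the covers along the ignored axis, which evaluate to `0` (`Lit.tailOK = false`);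
* **`LitProdCert.of_succ : LitProdCert (d+1) n → LitProdCert d n`** and `LitProdCert.of_le` — restrict a certificate to cylinder families
  and divide by `n!` (`patternForm_comp_tail`: `patternForm_{d+1}(h ∘ tail) = n! · patternForm_d(h)`); so the format is antitone in `d`
  exactly like the obligation `SlotPatternPos` itself (`SlotPatternPos.of_succ`);
* **`not_litProdCert_three_of_three_le : 3 ≤ d → ¬ LitProdCert d 3`** — the gen-20 no-go lifts to EVERY dimension: no one-cut-edge-per-member
  certificate proves any order-3 cell `SlotPatternPos d 3`, `d ≥ 3` — the finite normal forms of Kahn's / Sahi's `C₃` for product measures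
  (`kahnConjecture_of_forall_slotPatternPos_three`).  Together with `LitProdCert 2 3` (gen 20) the order-3 row of the tensor-cone table is
  decided in the kernel: `LitProdCert d 3 ↔ d ≤ 2` for `1 ≤ d` (`litProdCert_three_iff`, using `LitProdCert.of_le` downward from `d = 2`).
HONEST LABEL: a proof-complexity statement about ONE certificate format; it says nothing about the truth of the open cells. [this work]
-/

namespace Summit.CriticalPhenomena.PercolationContinuityZ3.Theorems

open Finset Function Equiv
open Literature.Combinatorics.Sahi2008

namespace SahiSlot

section Dim

variable {d n : ℕ}

/-- The base literal read by a literal of `[n]^{d+1}` on cylinder families (axis `0` ignored): `bot ↦ bot`, `top ↦ top`,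
`cover p (b+1) ↦ cover (tail p) b`; covers along axis `0` are sent to `bot` (junk — they evaluate to `0`, see `Lit.tailOK`). [this work] -/
def Lit.tailLit : Lit (d + 1) n → Lit d n
  | .bot => .bot
  | .top => .top
  | .cover p a => if h : a = 0 then .bot else .cover (Fin.tail p) (a.pred h)

/-- A literal of `[n]^{d+1}` survives on cylinder families unless it is a cover along the ignored axis `0`. [this work] -/
def Lit.tailOK : Lit (d + 1) n → Bool
  | .cover _ a => decide (a ≠ 0)
  | _ => true

/-- **Literals on cylinders**: `ℓ(x ∘ tail) = ℓ.tailLit(x)` if `ℓ` is not an axis-`0` cover, and `0` otherwise. [this work] -/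
theorem Lit.eval_comp_tail (ℓ : Lit (d + 1) n) (x : Q d n → ℝ) :
    ℓ.eval (x ∘ Fin.tail) = if ℓ.tailOK then ℓ.tailLit.eval x else 0 := by
  cases ℓ with
  | bot =>
    simp only [Lit.tailOK, Lit.tailLit, if_true, Lit.eval, comp_apply]
    rfl
  | top =>
    simp only [Lit.tailOK, Lit.tailLit, if_true, Lit.eval, comp_apply]
    rfl
  | cover p a =>
    by_cases ha : a = 0
    · subst ha
      simp only [Lit.tailOK, ne_eq, not_true_eq_false, decide_false, Bool.false_eq_true, if_false, Lit.eval, comp_apply,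
        Fin.tail_update_zero, sub_self, dite_eq_ite, ite_self]
    · obtain ⟨b, rfl⟩ := Fin.exists_succ_eq.mpr ha
      have hdec : (decide (b.succ ≠ 0)) = true := by simp [ha]
      simp only [Lit.tailOK, hdec, if_true, Lit.tailLit, ha, dite_false, Fin.pred_succ, Lit.eval, comp_apply,
        Fin.tail_update_succ]
      rfl

/-- **Literal-product certificates are antitone in the dimension**: `LitProdCert (d+1) n → LitProdCert d n` (restrict to cylinders, divide by `n!`). [this work] -/
theorem LitProdCert.of_succ (h : LitProdCert (d + 1) n) : LitProdCert d n := by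
  obtain ⟨k, coef, J, hcoef, hid⟩ := h
  set c : ℝ := (Fintype.card (Perm (Fin n)) : ℝ) with hc
  have hcpos : 0 < c := by rw [hc]; exact_mod_cast Fintype.card_pos
  refine ⟨k, fun j => coef j / c * ∏ i, (if (J j i).tailOK then (1 : ℝ) else 0), fun j i => (J j i).tailLit, ?_, ?_⟩
  · intro j
    exact mul_nonneg (div_nonneg (hcoef j) hcpos.le) (prod_nonneg fun i _ => by split_ifs <;> norm_num)
  · intro U hU
    have h1 := hid (fun i => cylSet (U i)) fun i => isUpperSet_cylSet (hU i)
    simp_rw [setInd_cylSet] at h1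
    rw [patternForm_comp_tail] at h1
    simp_rw [Lit.eval_comp_tail] at h1
    rw [← hc] at h1
    -- `h1 : c * Φ = Σ_j coef_j Π_i (if ok then ℓ' else 0)`; split off the 0/1 indicator of "no axis-0 cover"
    have key : ∀ j : Fin k, (∏ i, if (J j i).tailOK then (J j i).tailLit.eval (setInd (U i)) else 0) =
        (∏ i, if (J j i).tailOK then (1 : ℝ) else 0) * ∏ i, (J j i).tailLit.eval (setInd (U i)) := by
      intro j
      rw [← prod_mul_distrib]
      refine prod_congr rfl fun i _ => ?_
      split_ifs <;> simp
    simp_rw [key] at h1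
    apply mul_left_cancel₀ hcpos.ne'
    rw [h1, mul_sum]
    refine sum_congr rfl fun j _ => ?_
    field_simp

/-- `LitProdCert d' n → LitProdCert d n` for `d ≤ d'`. [this work] -/
theorem LitProdCert.of_le {d d' : ℕ} (hdd' : d ≤ d') (h : LitProdCert d' n) : LitProdCert d n := by
  obtain ⟨k, rfl⟩ := Nat.exists_eq_add_of_le hdd'
  induction k with
  | zero => simpa using h
  | succ k ih => exact ih (Nat.le_add_right d k) (LitProdCert.of_succ (by rw [← Nat.add_assoc] at h; exact h))

/-- **No literal-product (Sherali–Adams level-1 / one-cut-edge-per-member) certificate exists for the order-3 slot cell in ANY dimension `d ≥ 3`.**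
[this work] -/
theorem not_litProdCert_three_of_three_le (hd : 3 ≤ d) : ¬ LitProdCert d 3 :=
  fun h => not_litProdCert_three_three (LitProdCert.of_le hd h)

/-- **The order-3 row of the tensor-cone table, decided**: a literal-product certificate for the slot cell `(d,3)` exists iff `d ≤ 2`
(`litProdCert_two_three` of gen 20 downward by `LitProdCert.of_le`; `not_litProdCert_three_three` upward by `LitProdCert.of_le`). [this work] -/
theorem litProdCert_three_iff : LitProdCert d 3 ↔ d ≤ 2 := by
  constructor
  · intro h
    by_contra hd
    exact not_litProdCert_three_of_three_le (by omega) h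
  · intro hd
    exact LitProdCert.of_le hd litProdCert_two_three

end Dim

end SahiSlot

end Summit.CriticalPhenomena.PercolationContinuityZ3.Theorems
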